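import Summits.QuantumFields.BalabanUV.Beta.FP.CompositeAveragingTablesInf
import Literature.MathematicalPhysics.QuantumFieldTheory.Balaban1983to89.Beta.BalabanStepW2

/-!
# `BalabanUV.Beta.FP.CompositeAveragingTablesLetters` — road «FP» for binder row D1, row **N1-J∞-W PART 3(b)**, FILE D3 of the part: THE LETTERS OF THE COMPOSITE
# AVERAGING TABLES — every `HComp Lc q λ H m` is a first-order VERTEX FAMILY at blocking `Lc^m` (`VertexFamily (HComp … m) (Lc^m) C_m δ_m`), from ONE decay letter of the
# one-step weight `q` and ONE vertex-family letter of the one-step Hessian table `H`, by induction on `m` through asym1's `comp`∕`BiLoc` calculus and an2's `cwsum`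

HONEST DEPENDENCY (page 1, mandatory): continuum YM on T⁴ ⇐ BetaPertH ∧ nine spine estimates (0/9 proved); BetaPertH ⇐ (D1) ∧ (D4) ∧ CAP+tail;
G-an2-4 gates asym, D1 and NE2/3/4.  HONEST FRAMING (cell contract, verbatim): «discharging `BetaPertH` makes Bałaban's UV stability UNCONDITIONAL —
a real constructive-QFT result; it is NOT the continuum limit and NOT the Clay problem.»  ABSOLUTE RULE (cell charter, verbatim): «No internally-minted
statement may enter as a cited fact. Every hypothesis is either kernel-proved in this package or a verbatim quotation of a PUBLISHED theorem with page
reference. The manuscript(s) under audit are NOT citable for their own disputed steps — they are the thing under adjudication; programme-internal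
(2001/route/tribunal) claims are never citable.»  THIS MODULE is [folklore] kernel bookkeeping (exponentially localised lattice sums; no `def`, no `def … : Prop`,
nothing cited, 0 sorry).  The two input letters are HYPOTHESIS SHAPES with free constants: (Lq) `|q ρ w κ u| ≤ Cq·e^{−δ|u − Lc•w|₁}` (the one-step linearised weight reads fine bonds
in an exponential window around its coarse bond) and (LH) `VertexFamily H Lc CH δ` (the `SymTables.hH` letter); asserted here for no object of Bałaban's.  0∕4 row-D1 binders;
NOT X1m, NOT (STEP), NOT D1, NOT BetaPertH, NOT continuum, NOT Clay.  «not in print; our bookkeeping».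

WHY.  FILE D2's pin `WtPin` makes the END's `WPerfOf … Wt m` (m ≥ 2) the explicit carrier `WtInf m`; the END's split∕extra-slot rows for `m ≥ 2` (`hsplit`, `hWx`) then ask for the LETTERS
of the composite tables at blocking `Lc^m` (an2's `vertexFamily₂`-lemmas for `mixOfK`∕`dM ∘ K2OfK` consume `VertexFamily (M m) (Lc^m)` and `LocStencilFM (Lc^m) (M₂ m)`).  This file supplies
the FIRST (multiplier tables; `MCompInf = cΛ • HComp` follows by `biLoc_smul`); the mixed tables (`M2Comp`, four families) are FILE D4.

CONTENT ([folklore]; generic `d`, `Lc` with `NeZero Lc`).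
* §1 `abs_tsum_conv_le` — THE SCALAR CONVOLUTION ON THE COARSE LATTICE: `|a v| ≤ A·e^{−α|Lc•v − P|₁}`, `|g v| ≤ Cg·e^{−α|u − Lc•v|₁}` ⟹ `|Σ'_v a v · g v| ≤ A·Cg·Zl(α/2)·e^{−(α/2)|u − P|₁}`.
* §2 `aComp_loc` — THE COMPOSITE WEIGHTS ARE LOCALISED: `|aComp q λ (m+1) ρ w κ u| ≤ A·e^{−α|u − Lc^{m+1}•w|₁}` (induction; rate degrades by `Lc` and a half per level — no optimality).
* §3 KERNEL LETTERS: `decays_wKer`∕`decays_wKerT`, `biLoc_upK` (`BiLoc X P P C δ → BiLoc (upK Lc X) (Lc•P) (Lc•P) C (δ∕Lc)`), `biLoc_hRow`∕`biLoc_hRowT` (`BiLoc (hRow Lc H κ u) u u CH (δ∕2)`).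
* §4 THE LIFTS: **`biLoc_liftF`** (uniform in `(X, P)`: `BiLoc X P P CX δX → BiLoc (liftF Lc q X) (Lc•P) (Lc•P) (K·CX) r`, `K, r` depending on `(Cq, δ, δX, Lc, d)` only);
  **`biLoc_liftFH`** (`… → BiLoc (liftFH Lc q H κ u X) u u (K·CX·e^{−r|u − Lc•P|₁}) r` — the `LocStencilFM` shape) by `biLoc_comp_biLoc` + `biLoc_recenter_left∕right`.
* §5 **`vertexFamily_HComp`**: `∀ m, ∃ C δ′, 0 < δ′ ∧ VertexFamily (HComp Lc q λ H (m+1)) (Lc^(m+1)) C δ′` (induction: `biLoc_cwsum` on the transported one-step tables, §4 on the lift).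
Provenance: D1 formalisation swarm LEAF PROVER 02, unit b2b-balaban-beta-d1-formalise-leaf-02 gen 13, 2026-08-21 (R-FP-44 (B) sizing «≈250 l. letters»).  No existing file touched.
-/

noncomputable section

namespace Summit.QuantumFields.BalabanUV.Beta.FP.CompositeAveragingTablesLetters

open Finset
open scoped BigOperators
open Literature.MathematicalPhysics.QuantumFieldTheory
open Literature.Probability.LatticeModels (Torus.proj)
open LatticeForm (quo)
open Literature.MathematicalPhysics.QuantumFieldTheory.Balaban1983to89
open Literature.MathematicalPhysics.QuantumFieldTheory.Balaban1983to89.Beta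
open B12Sec2to5 (l1 l1_nonneg)
open ExpKernelCalculus (MKer Decays BiLoc VertexFamily comp Zl Zl_nonneg l1_sub_triangle l1_sub_symm l1_natSmul summable_exp_shift tsum_exp_shift
  biLoc_comp_decays biLoc_comp_biLoc)
open AffineAveraging (Site)
open OneStepResolventKernel (Fib decays_mono biLoc_mono eq_zsmul_quo_of_proj biLoc_finset_sum)
open InterLevelTransport (cwsum cwsum_apply biLoc_cwsum)
open KernelWard (biLoc_add)
open SecondOrderResponse (biLoc_recenter_left biLoc_recenter_right biLoc_smul)
open BalabanStepJetsSucc (biLoc_comp_right)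
open BalabanStepW2 (biLoc_le_mono)
open Summit.QuantumFields.BalabanUV.Beta.FP.CompositeAveragingTablesInf

variable {d : ℕ} {Lc : ℕ} [NeZero Lc]

/-! ## §1 The scalar convolution on the coarse lattice -/

/-- [folklore] **EXPONENTIALLY LOCALISED WEIGHTS CONVOLVE TO AN EXPONENTIALLY LOCALISED WEIGHT** (coarse index `v`, coarse points `Lc•v` in fine units): if
`|a v| ≤ A·e^{−α|Lc•v − P|₁}` and `|g v| ≤ Cg·e^{−α|u − Lc•v|₁}` (`α > 0`, `A, Cg ≥ 0`) then `v ↦ a v · g v` is summable and `|Σ'_v a v · g v| ≤ A·Cg·Zl(α/2)·e^{−(α/2)|u − P|₁}`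
(triangle inequality at half rate; the sublattice sum of `e^{−(α/2)|u − Lc•v|₁}` is dominated by the full-lattice sum `Zl(α/2)`). -/
theorem abs_tsum_conv_le {a g : Site (d + 1) → ℝ} {A Cg α : ℝ} {P u : Site (d + 1)}
    (ha : ∀ v, |a v| ≤ A * Real.exp (-α * l1 ((Lc : ℤ) • v - P))) (hg : ∀ v, |g v| ≤ Cg * Real.exp (-α * l1 (u - (Lc : ℤ) • v)))
    (hα : 0 < α) (hA : 0 ≤ A) (hCg : 0 ≤ Cg) :
    Summable (fun v => a v * g v) ∧ |∑' v, a v * g v| ≤ A * Cg * Zl (d + 1) (α / 2) * Real.exp (-(α / 2) * l1 (u - P)) := by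
  have hinj : Function.Injective (fun v : Site (d + 1) => (Lc : ℤ) • v) := by
    intro v v' h
    have hL : (Lc : ℤ) ≠ 0 := by exact_mod_cast NeZero.ne Lc
    exact smul_right_injective (Site (d + 1)) hL h
  have hsf : Summable (fun y : Site (d + 1) => Real.exp (-(α / 2) * l1 (u - y))) := summable_exp_shift (half_pos hα) u
  have hsub : Summable (fun v : Site (d + 1) => Real.exp (-(α / 2) * l1 (u - (Lc : ℤ) • v))) := hsf.comp_injective hinj
  have hle_sub : ∑' v : Site (d + 1), Real.exp (-(α / 2) * l1 (u - (Lc : ℤ) • v)) ≤ Zl (d + 1) (α / 2) := by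
    rw [← tsum_exp_shift (c := α / 2) u]
    exact tsum_comp_le_tsum_of_inj hsf (fun y => (Real.exp_pos _).le) hinj
  have hterm : ∀ v, ‖a v * g v‖ ≤ (A * Cg * Real.exp (-(α / 2) * l1 (u - P))) * Real.exp (-(α / 2) * l1 (u - (Lc : ℤ) • v)) := by
    intro v
    rw [Real.norm_eq_abs, abs_mul]
    have h1 := ha v
    have h2 := hg v
    have tri : l1 (u - P) ≤ l1 (u - (Lc : ℤ) • v) + l1 ((Lc : ℤ) • v - P) := l1_sub_triangle u ((Lc : ℤ) • v) P
    calc |a v| * |g v| ≤ (A * Real.exp (-α * l1 ((Lc : ℤ) • v - P))) * (Cg * Real.exp (-α * l1 (u - (Lc : ℤ) • v))) :=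
          mul_le_mul h1 h2 (abs_nonneg _) ((abs_nonneg _).trans h1)
      _ = A * Cg * Real.exp (-α * l1 ((Lc : ℤ) • v - P) + -α * l1 (u - (Lc : ℤ) • v)) := by rw [Real.exp_add]; ring
      _ ≤ A * Cg * Real.exp (-(α / 2) * l1 (u - P) + -(α / 2) * l1 (u - (Lc : ℤ) • v)) := by
          refine mul_le_mul_of_nonneg_left (Real.exp_le_exp.2 ?_) (mul_nonneg hA hCg)
          nlinarith [l1_nonneg ((Lc : ℤ) • v - P), l1_nonneg (u - (Lc : ℤ) • v)]
      _ = (A * Cg * Real.exp (-(α / 2) * l1 (u - P))) * Real.exp (-(α / 2) * l1 (u - (Lc : ℤ) • v)) := by rw [Real.exp_add]; ring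
  have hmaj := hsub.mul_left (A * Cg * Real.exp (-(α / 2) * l1 (u - P)))
  refine ⟨Summable.of_norm_bounded hmaj hterm, ?_⟩
  have hb := tsum_of_norm_bounded hmaj.hasSum hterm
  rw [Real.norm_eq_abs] at hb
  refine hb.trans ?_
  rw [tsum_mul_left]
  have h0 : 0 ≤ A * Cg * Real.exp (-(α / 2) * l1 (u - P)) := by positivity
  calc A * Cg * Real.exp (-(α / 2) * l1 (u - P)) * ∑' v : Site (d + 1), Real.exp (-(α / 2) * l1 (u - (Lc : ℤ) • v))
      ≤ A * Cg * Real.exp (-(α / 2) * l1 (u - P)) * Zl (d + 1) (α / 2) := mul_le_mul_of_nonneg_left hle_sub h0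
    _ = A * Cg * Zl (d + 1) (α / 2) * Real.exp (-(α / 2) * l1 (u - P)) := by ring


/-! ## §2 The composite weights are localised -/

section Weights

variable {q : Fin (d + 1) → Site (d + 1) → Fin (d + 1) → Site (d + 1) → ℝ} {Cq δ : ℝ}

omit [NeZero Lc] in
/-- [folklore] Index bookkeeping: `Lc • (Lc^(m+1) • w) = Lc^(m+2) • w` in `ℤ^{d+1}`. -/
theorem smul_pow_succ (m : ℕ) (w : Site (d + 1)) : (Lc : ℤ) • (((Lc ^ (m + 1) : ℕ) : ℤ) • w) = ((Lc ^ (m + 2) : ℕ) : ℤ) • w := by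
  rw [smul_smul, ← Nat.cast_mul, show Lc * Lc ^ (m + 1) = Lc ^ (m + 2) by ring]

/-- [folklore] Re-reading a localisation on the coarse INDEX lattice as a localisation of the coarse POINTS in fine units: `e^{−α|v − W|₁} = e^{−(α/Lc)|Lc•v − Lc•W|₁}`. -/
theorem exp_index_eq (α : ℝ) (v W : Site (d + 1)) :
    Real.exp (-α * l1 (v - W)) = Real.exp (-(α / Lc) * l1 ((Lc : ℤ) • v - (Lc : ℤ) • W)) := by
  have hL : (Lc : ℝ) ≠ 0 := by exact_mod_cast NeZero.ne Lc
  rw [← smul_sub, l1_natSmul]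
  congr 1
  field_simp

/-- [folklore] **(Lq) ⟹ THE COMPOSITE LINEARISED WEIGHTS ARE LOCALISED**: `∀ m, ∃ A α, 0 ≤ A ∧ 0 < α ∧ |aComp q λ (m+1) ρ w κ u| ≤ A·e^{−α|u − Lc^{m+1}•w|₁}` — the (m+1)-fold
weight reads the fine bond `(κ, u)` in an exponential window around its coarse bond's point `Lc^{m+1}•w` (induction: the upper weights one index-level up, §1's convolution with
the one-step weight, a finite sum over the intermediate axis; the rate degrades to `min (α∕Lc) δ ∕ 2` per level — no optimality claimed). -/
theorem aComp_loc (hq : ∀ ρ w κ u, |q ρ w κ u| ≤ Cq * Real.exp (-δ * l1 (u - (Lc : ℤ) • w))) (hCq : 0 ≤ Cq) (hδ : 0 < δ) (lam : ℝ) :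
    ∀ m : ℕ, ∃ A α : ℝ, 0 ≤ A ∧ 0 < α ∧ ∀ (ρ : Fin (d + 1)) (w : Site (d + 1)) (κ : Fin (d + 1)) (u : Site (d + 1)),
      |aComp q lam (m + 1) ρ w κ u| ≤ A * Real.exp (-α * l1 (u - ((Lc ^ (m + 1) : ℕ) : ℤ) • w))
  | 0 => ⟨Cq, δ, hCq, hδ, fun ρ w κ u => by
      rw [aComp_one, show ((Lc ^ (0 + 1) : ℕ) : ℤ) = (Lc : ℤ) by rw [Nat.zero_add, pow_one]]
      exact hq ρ w κ u⟩
  | m + 1 => by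
    obtain ⟨A, α, hA, hα, h⟩ := aComp_loc hq hCq hδ lam m
    have hL : (0 : ℝ) < Lc := by exact_mod_cast Nat.pos_of_ne_zero (NeZero.ne Lc)
    set β : ℝ := min (α / Lc) δ with hβ
    have hβ0 : 0 < β := lt_min (div_pos hα hL) hδ
    have hβ1 : β ≤ α / Lc := min_le_left _ _
    have hβ2 : β ≤ δ := min_le_right _ _
    have hZ := Zl_nonneg (D := d + 1) (half_pos hβ0)
    refine ⟨|lam| * ((d + 1 : ℕ) * (A * Cq * Zl (d + 1) (β / 2))), β / 2, by positivity, by positivity, fun ρ w κ u => ?_⟩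
    have hconv : ∀ σ : Fin (d + 1), Summable (fun v => aComp q lam (m + 1) ρ w σ v * q σ v κ u) ∧
        |∑' v, aComp q lam (m + 1) ρ w σ v * q σ v κ u| ≤ A * Cq * Zl (d + 1) (β / 2) * Real.exp (-(β / 2) * l1 (u - ((Lc ^ (m + 2) : ℕ) : ℤ) • w)) := by
      intro σ
      have ha : ∀ v, |aComp q lam (m + 1) ρ w σ v| ≤ A * Real.exp (-β * l1 ((Lc : ℤ) • v - ((Lc ^ (m + 2) : ℕ) : ℤ) • w)) := fun v => by
        refine (h ρ w σ v).trans (mul_le_mul_of_nonneg_left ?_ hA)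
        rw [exp_index_eq (Lc := Lc) α v, smul_pow_succ]
        exact Real.exp_le_exp.2 (by nlinarith [l1_nonneg ((Lc : ℤ) • v - ((Lc ^ (m + 2) : ℕ) : ℤ) • w)])
      have hg : ∀ v, |q σ v κ u| ≤ Cq * Real.exp (-β * l1 (u - (Lc : ℤ) • v)) := fun v =>
        (hq σ v κ u).trans (mul_le_mul_of_nonneg_left (Real.exp_le_exp.2 (by nlinarith [l1_nonneg (u - (Lc : ℤ) • v)])) hCq)
      exact abs_tsum_conv_le ha hg hβ0 hA hCq
    rw [aComp_succ_succ, Summable.tsum_finsetSum (fun σ _ => (hconv σ).1), abs_mul]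
    refine (mul_le_mul_of_nonneg_left (Finset.abs_sum_le_sum_abs _ _) (abs_nonneg lam)).trans ?_
    have hsum : ∑ σ : Fin (d + 1), |∑' v, aComp q lam (m + 1) ρ w σ v * q σ v κ u|
        ≤ (d + 1 : ℕ) * (A * Cq * Zl (d + 1) (β / 2) * Real.exp (-(β / 2) * l1 (u - ((Lc ^ (m + 2) : ℕ) : ℤ) • w))) := by
      refine (Finset.sum_le_sum fun σ _ => (hconv σ).2).trans (le_of_eq ?_)
      rw [Finset.sum_const, Finset.card_univ, Fintype.card_fin, nsmul_eq_mul]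
    refine (mul_le_mul_of_nonneg_left hsum (abs_nonneg lam)).trans (le_of_eq ?_)
    ring

end Weights

/-! ## §3 Kernel letters: the one-step data as fine-lattice kernels -/

section Kernels

variable {q : Fin (d + 1) → Site (d + 1) → Fin (d + 1) → Site (d + 1) → ℝ} {Cq δ : ℝ}

/-- [folklore] **(Lq) ⟹ `wKer` DECAYS**: `Decays (wKer Lc q) Cq δ` (on the sublattice `y = Lc•quo y` the entry is the weight, bounded by `Cq·e^{−δ|x − y|₁}`; elsewhere `0`). -/
theorem decays_wKer (hq : ∀ ρ w κ u, |q ρ w κ u| ≤ Cq * Real.exp (-δ * l1 (u - (Lc : ℤ) • w))) (hCq : 0 ≤ Cq) : Decays (wKer Lc q) Cq δ := by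
  intro y x e a
  have h0 : (0 : ℝ) ≤ Cq * Real.exp (-δ * l1 (y - x)) := by positivity
  rcases e with σ | m
  · rcases a with κ | m
    · rw [wKer_inl_inl]
      split_ifs with hy
      · have e := eq_zsmul_quo_of_proj (N := Lc) hy
        have h := hq σ (quo Lc y) κ x
        rw [← e, l1_sub_symm] at h
        exact h
      · rw [abs_zero]; exact h0
    · rw [wKer_inl_inr, abs_zero]; exact h0
  · rw [wKer_inr, abs_zero]; exact h0

/-- [folklore] … and so does its transpose. -/
theorem decays_wKerT (hq : ∀ ρ w κ u, |q ρ w κ u| ≤ Cq * Real.exp (-δ * l1 (u - (Lc : ℤ) • w))) (hCq : 0 ≤ Cq) : Decays (wKerT Lc q) Cq δ := by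
  intro x y a e
  rw [wKerT_apply, l1_sub_symm]
  exact decays_wKer hq hCq y x e a

/-- [folklore] **THE EXTENSION BY ZERO IS BI-LOCALISED AT THE DILATED CENTRE** with the rate divided by `Lc`: `BiLoc X P P C δ → BiLoc (upK Lc X) (Lc•P) (Lc•P) C (δ∕Lc)`
(`|Lc•x′ − Lc•P|₁ = Lc·|x′ − P|₁`). -/
theorem biLoc_upK {X : MKer (d + 1) (Fib d)} {P : Site (d + 1)} {C δX : ℝ} (hX : BiLoc X P P C δX) :
    BiLoc (upK Lc X) ((Lc : ℤ) • P) ((Lc : ℤ) • P) C (δX / Lc) := by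
  have hC : 0 ≤ C := hX.nonneg (Sum.inl 0)
  have hL : (0 : ℝ) < Lc := by exact_mod_cast Nat.pos_of_ne_zero (NeZero.ne Lc)
  intro y y' e f
  by_cases hy : Torus.proj Lc y = 0
  · by_cases hy' : Torus.proj Lc y' = 0
    · have ey := eq_zsmul_quo_of_proj (N := Lc) hy
      have ey' := eq_zsmul_quo_of_proj (N := Lc) hy'
      have h := hX (quo Lc y) (quo Lc y') e f
      have e1 : l1 (y - (Lc : ℤ) • P) = (Lc : ℝ) * l1 (quo Lc y - P) := by
        conv_lhs => rw [ey]
        rw [← smul_sub, l1_natSmul]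
      have e2 : l1 (y' - (Lc : ℤ) • P) = (Lc : ℝ) * l1 (quo Lc y' - P) := by
        conv_lhs => rw [ey']
        rw [← smul_sub, l1_natSmul]
      simp only [upK, hy, hy', and_self, if_true]
      refine h.trans (le_of_eq ?_)
      rw [e1, e2]
      congr 1
      field_simp
    · simp only [upK, hy', and_false, if_false, abs_zero]; positivity
  · simp only [upK, hy, false_and, if_false, abs_zero]; positivity

variable {H : Fin (d + 1) → Site (d + 1) → MKer (d + 1) (Fib d)} {CH : ℝ}

/-- [folklore] **(LH) ⟹ THE HESSIAN-ROW KERNEL IS BI-LOCALISED AT THE DIFFERENTIATED BOND**: `VertexFamily H Lc CH δ → BiLoc (hRow Lc H κ u) u u CH (δ∕2)` (the entry at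
`(x, Lc•x′)` is `(H σ x′) u x`, bounded by `CH·e^{−δ(|u − Lc•x′|₁ + |x − Lc•x′|₁)} ≤ CH·e^{−(δ/2)(|x − u|₁ + |Lc•x′ − u|₁)}`). -/
theorem biLoc_hRow (hH : VertexFamily H Lc CH δ) (hδ : 0 ≤ δ) (κ : Fin (d + 1)) (u : Site (d + 1)) : BiLoc (hRow Lc H κ u) u u CH (δ / 2) := by
  have hCH : 0 ≤ CH := (hH 0 0).nonneg (Sum.inl 0)
  intro x y a e
  have h0 : (0 : ℝ) ≤ CH * Real.exp (-(δ / 2) * (l1 (x - u) + l1 (y - u))) := by positivity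
  rcases a with α | m
  · rcases e with σ | m
    · rw [hRow_inl_inl]
      split_ifs with hy
      · have ey := eq_zsmul_quo_of_proj (N := Lc) hy
        have h := hH σ (quo Lc y) u x (Sum.inl κ) (Sum.inl α)
        rw [← ey] at h
        refine h.trans (mul_le_mul_of_nonneg_left (Real.exp_le_exp.2 ?_) hCH)
        have t1 : l1 (x - u) ≤ l1 (x - y) + l1 (y - u) := l1_sub_triangle x y u
        have e1 : l1 (u - y) = l1 (y - u) := l1_sub_symm u y
        nlinarith [l1_nonneg (x - y), l1_nonneg (y - u), l1_nonneg (x - u)]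
      · rw [abs_zero]; exact h0
    · rw [hRow_inl_inr, abs_zero]; exact h0
  · rw [hRow_inr, abs_zero]; exact h0

/-- [folklore] … and so is its transpose. -/
theorem biLoc_hRowT (hH : VertexFamily H Lc CH δ) (hδ : 0 ≤ δ) (κ : Fin (d + 1)) (u : Site (d + 1)) : BiLoc (hRowT Lc H κ u) u u CH (δ / 2) := by
  intro y x e a
  rw [hRowT_apply, add_comm]
  exact biLoc_hRow hH hδ κ u x y a e

end Kernels

/-! ## §4 The lifts are bi-localised -/

section Lifts

variable {q : Fin (d + 1) → Site (d + 1) → Fin (d + 1) → Site (d + 1) → ℝ} {Cq δ : ℝ}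
  {H : Fin (d + 1) → Site (d + 1) → MKer (d + 1) (Fib d)} {CH : ℝ}

omit [NeZero Lc] in
/-- [folklore] Weakening the FAR factor of a constant: `C·e^{−a·L} ≤ C·e^{−a′·L}` for `a′ ≤ a`, `L ≥ 0`. -/
theorem biLoc_far_mono {K : MKer (d + 1) (Fib d)} {p p' : Site (d + 1)} {C a a' r : ℝ} {L : ℝ} (h : BiLoc K p p' (C * Real.exp (-a * L)) r)
    (hC : 0 ≤ C) (hL : 0 ≤ L) (ha : a' ≤ a) : BiLoc K p p' (C * Real.exp (-a' * L)) r :=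
  biLoc_le_mono h (by positivity) (mul_le_mul_of_nonneg_left (Real.exp_le_exp.2 (by nlinarith)) hC) le_rfl

/-- [folklore] **THE FIELD-LEG LIFT IS BI-LOCALISED AT THE DILATED CENTRE, UNIFORMLY IN THE LIFTED KERNEL**: from (Lq) and a rate `δX > 0` there are `K ≥ 0`, `r > 0`
(depending on `Cq, δ, δX, Lc, d` only) with `BiLoc X P P CX δX → BiLoc (liftF Lc q X) (Lc•P) (Lc•P) (K·CX) r` for EVERY `X`, `P`, `CX` (`biLoc_comp_decays`, `biLoc_comp_right`). -/
theorem biLoc_liftF (hq : ∀ ρ w κ u, |q ρ w κ u| ≤ Cq * Real.exp (-δ * l1 (u - (Lc : ℤ) • w))) (hCq : 0 ≤ Cq) (hδ : 0 < δ) {δX : ℝ} (hδX : 0 < δX) :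
    ∃ K r : ℝ, 0 ≤ K ∧ 0 < r ∧ ∀ (X : MKer (d + 1) (Fib d)) (P : Site (d + 1)) (CX : ℝ), BiLoc X P P CX δX →
      BiLoc (liftF Lc q X) ((Lc : ℤ) • P) ((Lc : ℤ) • P) (K * CX) r := by
  have hL : (0 : ℝ) < Lc := by exact_mod_cast Nat.pos_of_ne_zero (NeZero.ne Lc)
  set s : ℝ := min δ (δX / Lc) with hs
  have hs0 : 0 < s := lt_min hδ (div_pos hδX hL)
  have hsδ : s ≤ δ := min_le_left _ _
  have hsX : s ≤ δX / Lc := min_le_right _ _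
  have hZ2 := Zl_nonneg (D := d + 1) (show 0 < s / 2 by positivity)
  have hZ4 := Zl_nonneg (D := d + 1) (show 0 < s / 4 by positivity)
  refine ⟨(Fintype.card (Fib d) : ℝ) * ((Fintype.card (Fib d) : ℝ) * Cq * Zl (d + 1) (s / 2) * Cq) * Zl (d + 1) (s / 4), s / 4,
    by positivity, by positivity, fun X P CX hX => ?_⟩
  have hCX : 0 ≤ CX := hX.nonneg (Sum.inl 0)
  have hup : BiLoc (upK Lc X) ((Lc : ℤ) • P) ((Lc : ℤ) • P) CX s := biLoc_mono (biLoc_upK hX) hCX hsX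
  have hT : Decays (wKerT Lc q) Cq s := decays_mono (decays_wKerT hq hCq) hCq le_rfl hsδ
  have h1 := biLoc_comp_decays hT hup (show (0 : ℝ) ≤ s / 2 by positivity) (by linarith)
  rw [show s - s / 2 = s / 2 by ring] at h1
  have hK : Decays (wKer Lc q) Cq (s / 2) := decays_mono (decays_wKer hq hCq) hCq le_rfl (by linarith)
  have h2 := biLoc_comp_right h1 hK (show (0 : ℝ) ≤ s / 4 by positivity) (by linarith)
  rw [show s / 2 - s / 4 = s / 4 by ring] at h2
  refine biLoc_le_mono h2 (by positivity) (le_of_eq ?_) le_rfl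
  ring

/-- [folklore] **THE `U`-DERIVATIVE OF THE LIFT IS BI-LOCALISED AT THE DIFFERENTIATED BOND WITH A FAR FACTOR IN THE DILATED CENTRE** (the `LocStencilFM` shape, uniformly in
the lifted kernel): `BiLoc X P P CX δX → BiLoc (liftFH Lc q H κ u X) u u (K·CX·e^{−r|u − Lc•P|₁}) r` for every `X, P, CX, κ, u` (`biLoc_comp_biLoc` supplies the far factor,
`biLoc_recenter_left∕right` trade half of it for the common centre). -/
theorem biLoc_liftFH (hq : ∀ ρ w κ u, |q ρ w κ u| ≤ Cq * Real.exp (-δ * l1 (u - (Lc : ℤ) • w))) (hCq : 0 ≤ Cq) (hδ : 0 < δ)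
    (hH : VertexFamily H Lc CH δ) {δX : ℝ} (hδX : 0 < δX) :
    ∃ K r : ℝ, 0 ≤ K ∧ 0 < r ∧ ∀ (X : MKer (d + 1) (Fib d)) (P : Site (d + 1)) (CX : ℝ) (κ : Fin (d + 1)) (u : Site (d + 1)), BiLoc X P P CX δX →
      BiLoc (liftFH Lc q H κ u X) u u (K * CX * Real.exp (-r * l1 (u - (Lc : ℤ) • P))) r := by
  have hL : (0 : ℝ) < Lc := by exact_mod_cast Nat.pos_of_ne_zero (NeZero.ne Lc)
  have hCH : 0 ≤ CH := (hH 0 0).nonneg (Sum.inl 0)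
  set s : ℝ := min (δ / 2) (δX / Lc) with hs
  have hs0 : 0 < s := lt_min (half_pos hδ) (div_pos hδX hL)
  have hsδ : s ≤ δ / 2 := min_le_left _ _
  have hsX : s ≤ δX / Lc := min_le_right _ _
  set F : ℝ := (Fintype.card (Fib d) : ℝ) with hF
  have hZ2 := Zl_nonneg (D := d + 1) (show 0 < s / 2 by positivity)
  have hZ4 := Zl_nonneg (D := d + 1) (show 0 < s / 4 by positivity)
  set KA : ℝ := F * (F * CH * Zl (d + 1) (s / 2) * Cq) * Zl (d + 1) (s / 2) with hKA
  set KB : ℝ := F * (F * Cq * Zl (d + 1) (s / 2) * CH) * Zl (d + 1) (s / 4) with hKB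
  refine ⟨KA + KB, s / 8, by positivity, by positivity, fun X P CX κ u hX => ?_⟩
  have hCX : 0 ≤ CX := hX.nonneg (Sum.inl 0)
  have hLu : 0 ≤ l1 (u - (Lc : ℤ) • P) := l1_nonneg _
  have hup : BiLoc (upK Lc X) ((Lc : ℤ) • P) ((Lc : ℤ) • P) CX s := biLoc_mono (biLoc_upK hX) hCX hsX
  have hK : Decays (wKer Lc q) Cq s := decays_mono (decays_wKer hq hCq) hCq le_rfl (hsδ.trans (by linarith))
  have hT : Decays (wKerT Lc q) Cq s := decays_mono (decays_wKerT hq hCq) hCq le_rfl (hsδ.trans (by linarith))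
  have hR : BiLoc (hRow Lc H κ u) u u CH s := biLoc_mono (biLoc_hRow hH hδ.le κ u) hCH hsδ
  have hRT : BiLoc (hRowT Lc H κ u) u u CH (s / 2) := biLoc_mono (biLoc_hRowT hH hδ.le κ u) hCH (hsδ.trans' (by linarith))
  have hA1 := biLoc_comp_biLoc hR hup hs0
  have hA2 := biLoc_comp_right hA1 hK (show (0 : ℝ) ≤ s / 2 by positivity) (by linarith)
  rw [show s - s / 2 = s / 2 by ring] at hA2
  have hA3 : BiLoc (comp (comp (hRow Lc H κ u) (upK Lc X)) (wKer Lc q)) u ((Lc : ℤ) • P)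
      ((KA * CX * Real.exp (-(s / 4) * l1 (u - (Lc : ℤ) • P))) * Real.exp (-(s / 4) * l1 (u - (Lc : ℤ) • P))) (s / 4) := by
    refine biLoc_le_mono hA2 (by positivity) (le_of_eq ?_) (by linarith)
    rw [hKA, show -(s / 2) * l1 (u - (Lc : ℤ) • P) = -(s / 4) * l1 (u - (Lc : ℤ) • P) + -(s / 4) * l1 (u - (Lc : ℤ) • P) by ring, Real.exp_add]
    ring
  have hA := biLoc_recenter_right hA3 (by positivity) (by positivity) le_rfl
  have hB1 := biLoc_comp_decays hT hup (show (0 : ℝ) ≤ s / 2 by positivity) (by linarith)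
  rw [show s - s / 2 = s / 2 by ring] at hB1
  have hB2 := biLoc_comp_biLoc hB1 hRT (show (0 : ℝ) < s / 2 by positivity)
  rw [show s / 2 / 2 = s / 4 by ring, l1_sub_symm] at hB2
  have hB3 : BiLoc (comp (comp (wKerT Lc q) (upK Lc X)) (hRowT Lc H κ u)) ((Lc : ℤ) • P) u
      ((KB * CX * Real.exp (-(s / 8) * l1 (u - (Lc : ℤ) • P))) * Real.exp (-(s / 8) * l1 (u - (Lc : ℤ) • P))) (s / 8) := by
    refine biLoc_le_mono hB2 (by positivity) (le_of_eq ?_) (by linarith)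
    rw [hKB, show -(s / 4) * l1 (u - (Lc : ℤ) • P) = -(s / 8) * l1 (u - (Lc : ℤ) • P) + -(s / 8) * l1 (u - (Lc : ℤ) • P) by ring, Real.exp_add]
    ring
  have hB := biLoc_recenter_left hB3 (by positivity) (by positivity) le_rfl
  have hA' : BiLoc (comp (comp (hRow Lc H κ u) (upK Lc X)) (wKer Lc q)) u u (KA * CX * Real.exp (-(s / 8) * l1 (u - (Lc : ℤ) • P))) (s / 8) :=
    biLoc_mono (biLoc_far_mono hA (by positivity) hLu (by linarith)) (by positivity) (by linarith)
  have hsum := biLoc_add hA' hB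
  unfold liftFH
  refine biLoc_le_mono hsum (by positivity) (le_of_eq ?_) le_rfl
  ring

end Lifts

/-! ## §5 The composite constraint Hessians are vertex families at blocking `Lc^m` -/

section Tables

variable {q : Fin (d + 1) → Site (d + 1) → Fin (d + 1) → Site (d + 1) → ℝ} {Cq δ : ℝ}
  {H : Fin (d + 1) → Site (d + 1) → MKer (d + 1) (Fib d)} {CH : ℝ}

/-- [our object — bookkeeping] **EVERY COMPOSITE CONSTRAINT HESSIAN IS A FIRST-ORDER VERTEX FAMILY AT ITS OWN BLOCKING**: from (Lq) and (LH), for every `m` there are `C`,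
`δ′ > 0` with `VertexFamily (HComp Lc q λ H (m+1)) (Lc^(m+1)) C δ′` (uniformly in the coarse bond).  Induction: member `m+2` = `λ • Σ_σ cwsum Lc (aComp (m+1) ρ w σ) (H σ)`
(an2's `biLoc_cwsum`, §2's weights re-read at the coarse points) `+ λ² • liftF Lc q (HComp (m+1) ρ w)` (§4 on the induction hypothesis).  Discharges nothing by itself. -/
theorem vertexFamily_HComp (hq : ∀ ρ w κ u, |q ρ w κ u| ≤ Cq * Real.exp (-δ * l1 (u - (Lc : ℤ) • w))) (hCq : 0 ≤ Cq) (hδ : 0 < δ)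
    (hH : VertexFamily H Lc CH δ) (lam : ℝ) :
    ∀ m : ℕ, ∃ C δ' : ℝ, 0 < δ' ∧ VertexFamily (HComp Lc q lam H (m + 1)) (Lc ^ (m + 1)) C δ'
  | 0 => ⟨CH, δ, hδ, by
      rw [HComp_one, show Lc ^ (0 + 1) = Lc by rw [Nat.zero_add, pow_one]]
      exact hH⟩
  | m + 1 => by
    obtain ⟨C, δ₁, hδ₁, hX⟩ := vertexFamily_HComp hq hCq hδ hH lam m
    obtain ⟨A, α, hA, hα, ha⟩ := aComp_loc hq hCq hδ lam m
    obtain ⟨K, r, hK, hr, hlift⟩ := biLoc_liftF (Lc := Lc) hq hCq hδ hδ₁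
    haveI : NeZero (Lc ^ (m + 1)) := ⟨pow_ne_zero _ (NeZero.ne Lc)⟩
    have hL : (0 : ℝ) < Lc := by exact_mod_cast Nat.pos_of_ne_zero (NeZero.ne Lc)
    have hCH : 0 ≤ CH := (hH 0 0).nonneg (Sum.inl 0)
    have hC : 0 ≤ C := (hX 0 0).nonneg (Sum.inl 0)
    set β : ℝ := min (α / Lc) δ with hβ
    have hβ0 : 0 < β := lt_min (div_pos hα hL) hδ
    have hβ1 : β ≤ α / Lc := min_le_left _ _
    have hβ2 : β ≤ δ := min_le_right _ _
    set t : ℝ := min (β / 2) r with ht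
    have ht0 : 0 < t := lt_min (half_pos hβ0) hr
    have hZ := Zl_nonneg (D := d + 1) (half_pos hβ0)
    refine ⟨|lam| * ((d + 1 : ℕ) * (A * CH * Zl (d + 1) (β / 2))) + |lam ^ 2| * (K * C), t, ht0, fun ρ w => ?_⟩
    have hT : ∀ σ : Fin (d + 1), BiLoc (cwsum Lc (aComp q lam (m + 1) ρ w σ) (H σ)) (((Lc ^ (m + 2) : ℕ) : ℤ) • w) (((Lc ^ (m + 2) : ℕ) : ℤ) • w)
        (A * CH * Zl (d + 1) (β / 2)) (β / 2) := by
      intro σ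
      have hw : ∀ y, |aComp q lam (m + 1) ρ w σ y| ≤ A * Real.exp (-β * l1 ((Lc : ℤ) • y - ((Lc ^ (m + 2) : ℕ) : ℤ) • w)) := fun y => by
        refine (ha ρ w σ y).trans (mul_le_mul_of_nonneg_left ?_ hA)
        rw [exp_index_eq (Lc := Lc) α y, smul_pow_succ]
        exact Real.exp_le_exp.2 (by nlinarith [l1_nonneg ((Lc : ℤ) • y - ((Lc ^ (m + 2) : ℕ) : ℤ) • w)])
      have hQ : ∀ y, BiLoc (H σ y) ((Lc : ℤ) • y) ((Lc : ℤ) • y) CH β := fun y => biLoc_mono (hH σ y) hCH hβ2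
      exact biLoc_cwsum hw hQ hβ0 hA
    have hsumσ := biLoc_finset_sum (Finset.univ : Finset (Fin (d + 1))) (fun σ _ => hT σ)
    simp only [Finset.sum_const, Finset.card_univ, Fintype.card_fin, nsmul_eq_mul] at hsumσ
    have h1 := biLoc_smul lam hsumσ
    have h2 : BiLoc (liftF Lc q (HComp Lc q lam H (m + 1) ρ w)) (((Lc ^ (m + 2) : ℕ) : ℤ) • w) (((Lc ^ (m + 2) : ℕ) : ℤ) • w) (K * C) r := by
      have h := hlift (HComp Lc q lam H (m + 1) ρ w) (((Lc ^ (m + 1) : ℕ) : ℤ) • w) C (hX ρ w)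
      rwa [smul_pow_succ] at h
    have h2' := biLoc_smul (lam ^ 2) h2
    have e : HComp Lc q lam H (m + 2) ρ w = lam • (∑ σ : Fin (d + 1), cwsum Lc (aComp q lam (m + 1) ρ w σ) (H σ)) +
        (lam ^ 2) • liftF Lc q (HComp Lc q lam H (m + 1) ρ w) := HComp_succ_succ Lc q lam H m ρ w
    rw [show m + 1 + 1 = m + 2 by ring, e]
    have hfn : (∑ σ : Fin (d + 1), cwsum Lc (aComp q lam (m + 1) ρ w σ) (H σ))
        = fun x z a b => ∑ σ : Fin (d + 1), cwsum Lc (aComp q lam (m + 1) ρ w σ) (H σ) x z a b := by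
      funext x z a b
      simp only [Finset.sum_apply]
    rw [hfn]
    exact biLoc_add (biLoc_mono h1 (by positivity) (min_le_left _ _)) (biLoc_mono h2' (by positivity) (min_le_right _ _))

end Tables

end Summit.QuantumFields.BalabanUV.Beta.FP.CompositeAveragingTablesLetters

end
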